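import Summits.QuantumFields.YangMills.Theses.PencilRigidity

/-!
# `DiagonalMirrorRPR` — negative lemma: negative coupling on the statement's ODD tori is the maximal
# 't Hooft twist (`SU(2)`): the ℤ₂ parity obstruction, slice by slice

Supports crux item `stmt-QuantumFields-10604` (`PencilRigidity.DiagonalMirrorRPR` =
`MirrorModularBoosts.DiagonalMirrorRPR`; standing-disprover work file `Cruxes/DiagonalMirrorRPR/Disproof.lean`,
§10, cycle 3).  The crux leaves the scheme's inverse couplings `sch.β k ∈ ℝ` unconstrained, while the intended
proof's diagonal Schur cut of Wilson's plaquette action needs `β ≥ 0` (Disproof §5).  For `SU(2)` in the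
fundamental representation (`−1 = ρ(−1)` a scalar) the change of variables `U_e ↦ ε_e U_e`, `ε_e = ±1`, maps
coupling `β` with plaquette signs `η_p` to coupling `β` with signs `η_p (δε)_p`, so NEGATIVE coupling is positive
coupling with all plaquette signs `−1`.  On `ℤ⁴` and on EVEN tori the all-`(−1)` field is a coboundary
(`even_torus_fully_frustrated`: `ε(x,e₁) = parity(x₀)`), hence `β < 0 ≡ β > 0` exactly; on the statement's ODD
tori `(ℤ/(2L+1))⁴` it is not: in every coordinate 2-torus slice no ℤ₂ edge field has all `S²` plaquettes equal
to `−1`, because every edge lies in two plaquettes (`sum_plaq`) while `S²` is odd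
(`odd_torus_not_fully_frustrated`).  The all-`(−1)` class is the maximal 't Hooft twist `n_μν ≡ 1 (mod 2)`.
Consequences recorded for the crux: `β_k < 0` on the statement's tori is `|β_k|` with twisted boundary conditions
— no counterexample expected in a massive phase (twist free energies vanish / are string-suppressed with the
volume), but the `β ≥ 0` restriction of the intended proof is not removable by the sign flip on odd geometries.
['t Hooft, Nucl. Phys. B 153 (1979) 141 (twisted boundary conditions); FILS II, J. Stat. Phys. 22 (1980), §3.]
-/

namespace Summit.QuantumFields.YangMills.Theorems.DiagonalMirrorRPR.Negative.OddTorusTwist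

/-- Sites of a coordinate 2-torus slice `(ℤ/S)²` of the statement's 4-torus. [folklore] -/
abbrev T2 (S : ℕ) : Type := ZMod S × ZMod S

variable {S : ℕ}

/-- ℤ₂-valued plaquette of an edge-sign field `ε` (direction `0`/`1` = the `e₀`/`e₁`-edge issuing from the
site; additive `ℤ₂`, so orientations are immaterial): `ε(x,0) + ε(x+e₀,1) + ε(x+e₁,0) + ε(x,1)`. [folklore] -/
def plaq (ε : T2 S → Fin 2 → ZMod 2) (x : T2 S) : ZMod 2 :=
  ε x 0 + ε (x + (1, 0)) 1 + ε (x + (0, 1)) 0 + ε x 1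

/-- Every edge lies in exactly two plaquettes: `∑ₓ plaq ε x = 0` in `ℤ₂` (any `S`). [folklore] -/
theorem sum_plaq [NeZero S] (ε : T2 S → Fin 2 → ZMod 2) : ∑ x, plaq ε x = 0 := by
  simp only [plaq, Finset.sum_add_distrib]
  have h1 : ∑ x : T2 S, ε (x + (1, 0)) 1 = ∑ x : T2 S, ε x 1 :=
    Fintype.sum_equiv (Equiv.addRight ((1, 0) : T2 S)) _ _ fun _ => rfl
  have h2 : ∑ x : T2 S, ε (x + (0, 1)) 0 = ∑ x : T2 S, ε x 0 :=
    Fintype.sum_equiv (Equiv.addRight ((0, 1) : T2 S)) _ _ fun _ => rfl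
  rw [h1, h2]
  have key : ∀ a b : ZMod 2, a + b + a + b = 0 := by decide
  exact key _ _

/-- **Odd 2-tori cannot be fully frustrated**: for odd `S` no ℤ₂ edge-sign field on `(ℤ/S)²` has all `S²`
plaquettes equal to `−1` (additively `1`), since `∑ₓ plaq = 0` while `S² ≡ 1 (mod 2)`.  GAUGE READING (`SU(2)`,
fundamental `ρ`, centre `−1 = ρ(−1)` scalar): the change of variables `U_e ↦ ε_e U_e` maps Wilson's weight at
coupling `β` with plaquette signs `η_p` to coupling `β` with signs `η_p·(δε)_p`; NEGATIVE coupling is positive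
coupling with all signs `−1`; on `ℤ⁴` and on EVEN tori the all-`(−1)` sign field is a coboundary
(`even_torus_fully_frustrated`), so there `β < 0 ≡ β > 0` exactly, but on the statement's ODD tori
`(ℤ/(2L+1))⁴` it is not — its class is the maximal 't Hooft twist `n_μν ≡ 1 (mod 2)` in all six planes (this
lemma, slice by slice).  So `β_k < 0` (allowed by the crux) on the statement's tori is `|β_k|` with twisted
boundary conditions: no counterexample is expected (twist free energies of a massive phase vanish / are
string-suppressed in the volume), but the intended proof's diagonal Schur cut (`β ≥ 0`) has no `β < 0` analogue
and the sign flip does not restore it on odd geometries. [folklore] -/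
theorem odd_torus_not_fully_frustrated [NeZero S] (hS : Odd S) (ε : T2 S → Fin 2 → ZMod 2) :
    ¬ ∀ x, plaq ε x = 1 := by
  intro h
  have hsum := sum_plaq ε
  simp only [h, Finset.sum_const, Finset.card_univ, nsmul_eq_mul, mul_one] at hsum
  rw [Fintype.card_prod, ZMod.card, Nat.cast_mul] at hsum
  have hodd : ((S : ZMod 2)) = 1 := by
    rcases hS with ⟨k, rfl⟩
    push_cast
    have : (2 : ZMod 2) = 0 := by decide
    rw [this]; ring
  rw [hodd, mul_one] at hsum
  exact one_ne_zero hsum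

/-- **Even 2-tori are fully frustratable**: on `(ℤ/2M)²` the edge signs `ε(x, e₁) = parity(x₀)`, `ε(x, e₀) = 0`
make every plaquette `−1`; hence for `SU(2)` (fundamental) Wilson theory on even tori and on `ℤ⁴`, coupling `−β`
is coupling `β` after a Haar-preserving change of variables. [folklore] -/
theorem even_torus_fully_frustrated (M : ℕ) [NeZero M] :
    ∃ ε : T2 (2 * M) → Fin 2 → ZMod 2, ∀ x, plaq ε x = 1 := by
  haveI : NeZero (2 * M) := ⟨mul_ne_zero two_ne_zero (NeZero.ne M)⟩
  let π : ZMod (2 * M) →+* ZMod 2 := ZMod.castHom (dvd_mul_right 2 M) (ZMod 2)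
  refine ⟨fun x μ => if μ = 1 then π x.1 else 0, fun x => ?_⟩
  simp only [plaq, ↓reduceIte, Prod.fst_add, map_add, map_one, add_zero]
  have key : ∀ a : ZMod 2, a + 1 + a = 1 := by decide
  simpa [add_comm, add_left_comm, add_assoc] using key (π x.1)

end Summit.QuantumFields.YangMills.Theorems.DiagonalMirrorRPR.Negative.OddTorusTwist
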